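import Literature.AnabelianGeometry.EtaleTheta.KummerDataYCoord
import HarnessLib

/-!
# `log(U) ∉ F²` for Kummer data built from a Kummer core — generic over a theta setting (R78 F6 / F6q)

Mochizuki, *The étale theta function …*, Publ. RIMS **45** (2009) [EtTh], §1, Prop. 1.5 (i)(ii), PRIMS PDF p. 23
[cite: MochizukiEtTh2009, Prop 1.5 p.23]: in the Leray–Serre filtration of `H¹((Π^tp_Y)^Θ, Δ_Θ)`,
`F² = H¹(G_K, Δ_Θ) ⥲ (K^×)^∧` — the Kummer classes of CONSTANTS, inflated from `G_K` — and `F¹/F² = Ẑ · log(U)`;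
likewise `F̈² ⥲ (K̈^×)^∧`, `F̈¹/F̈² = Ẑ · log(Ü)`.

PROOF-ONLY, GENERIC form (abc-iut cell, R78 cluster; seat abc-iut-w5-d181, generalising its model-level file
`SettingModelChiKummerDataFiltration.lean` (p437570) over abc-iut-w5-d171's `ThetaSetting.KummerCore` /
`KummerCore.toKummerData` (`KummerDataOfCore.lean`) and `ThetaSetting.YCoordKit` (`KummerDataYCoord.lean`)): for ANY
theta setting `D`, ANY Kummer core `C` and ANY element `h` of `(Π^tp_Y)^Θ` (resp. `(Π^tp_Ÿ)^Θ`) with TRIVIAL GALOIS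
PART `C.augTheta h = 1` which CENTRALISES `Δ_Θ`:

* `KummerCore.kummerCocycle_eq_one_of_augTheta_eq_one` — the Kummer cocycle of every invariant constant vanishes at `h`;
* `KummerCore.toKummerData_kumY_ne_mk` / `…_kumYdd_ne_mk` — no constant has the class of a cocycle `f` with `f h ≠ 1`;
* for a `y`-coordinate kit `K` with `ι` injective and `ŷ(h) ≠ 1`: `YCoordKit.kumY_ne_logU`,
  `YCoordKit.logU_not_mem_range_kumY` (**`log(U) ∉ F²`**), `YCoordKit.res_deltaTheta_logU` (`log(U) ∈ F¹` when `ŷ|_{Δ_Θ} = 0`),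
  `YCoordKit.kumY_ne_logU_zpow` (`log(U)^n ∉ F²`, `n ≠ 0`;
  `Ẑ` is torsion-free), `YCoordKit.kumYdd_ne_logUdd`, `YCoordKit.logUdd_not_mem_range_kumYdd` (**`log(Ü) ∉ F̈²`**).

At a model the hypotheses cost one geometric element (`b ∈ Δ^tp_Y`, resp. `b² ∈ Δ^tp_Ÿ`): this serves the χ-twisted
root model (stage 1) and the Tate-sheared model (stage 2, F6q) alike.  HONEST FRAMING: theorems about the typed
interface and its class-(b) constructions; nothing of [EtTh] is asserted; no definition, no new Prop fact; no side
taken on [IUTchIII] Cor. 3.12.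
-/

noncomputable section

open Topology

namespace Literature.AnabelianGeometry.EtaleTheta

open Literature.AnabelianGeometry.SemiGraphs

namespace ThetaSetting

variable {p : ℕ} [Fact p.Prime] {D : ThetaSetting p}

/-! ### Kummer cocycles of constants vanish at elements with trivial Galois part -/

namespace KummerCore

variable (C : D.KummerCore)

/-- **The Kummer cocycle of a constant is inflated from the Galois group**: for `H ≤ (Π^tp_X)^Θ`, an
`H`-invariant unit `a ∈ ℚ̄_p^×` (action through `aug^Θ`) with a compatible root system `r`, and `h ∈ H` with
`aug^Θ(h) = 1`, the Kummer cocycle `(h · r_n / r_n)_n` of `a` vanishes at `h`. [cite: MochizukiEtTh2009, Prop 1.5 p.23] -/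
theorem kummerCocycle_eq_one_of_augTheta_eq_one (H : Subgroup D.GtpTheta) {a : (PadicAlgCl p)ˣ}
    (r : RootSystem a)
    (ha : letI := D.unitsAction C.augTheta; a ∈ MulAction.fixedPoints H (PadicAlgCl p)ˣ)
    {h : D.GtpTheta} (hh : h ∈ H) (haug : C.augTheta h = 1) :
    letI := D.unitsAction C.augTheta
    r.kummerCocycle ha ⟨h, hh⟩ = 1 := by
  letI := D.unitsAction C.augTheta
  refine Subtype.ext (funext fun n => ?_)
  rw [RootSystem.kummerCocycle_apply]
  have hsm : ((⟨h, hh⟩ : H) • r.root n) = r.root n := by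
    change (C.augTheta h) • r.root n = r.root n
    rw [haug, one_smul]
  rw [hsm, div_self']
  rfl

/-- The Kummer map `kumYdd` of `C.toKummerData` IS the tree's continuous Kummer map on `(Π^tp_Ÿ)^Θ`
(companion of `toKummerData_kumY`). [cite: MochizukiEtTh2009, Prop 1.5 p.23] -/
theorem toKummerData_kumYdd (x : C.invYdd) :
    C.toKummerData.kumYdd x =
      (letI := D.unitsAction C.augTheta
       C.coeff.kummerContMap (D.GtpYdd.map D.toTheta) C.isOpen_stabilizer' x) :=
  rfl

/-- **No constant has the class of a cocycle that is non-trivial at a Galois-trivial, `Δ_Θ`-central element**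
of `(Π^tp_Y)^Θ`: if `aug^Θ(h) = 1`, `h` centralises `Δ_Θ`, and `f h ≠ 1`, then `kumY u ≠ [f]` for every
`u ∈ K^× = (ℚ̄_p^×)^{(Π^tp_Y)^Θ}` — Kummer cocycles of constants and coboundaries both vanish at `h`.
[cite: MochizukiEtTh2009, Prop 1.5 p.23] -/
theorem toKummerData_kumY_ne_mk (f : ↥(D.GtpY.map D.toTheta) → D.DeltaTheta)
    (hf : f ∈ contCocycles (MonoidHom.id D.GtpTheta) D.DeltaTheta (D.GtpY.map D.toTheta))
    {h : D.GtpTheta} (hh : h ∈ D.GtpY.map D.toTheta) (haug : C.augTheta h = 1)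
    (hcent : ∀ a : D.DeltaTheta, MulAut.conjNormal h a = a) (hfh : f ⟨h, hh⟩ ≠ 1) (u : C.invY) :
    C.toKummerData.kumY u ≠ ContH1.mk f hf := by
  letI := D.unitsAction C.augTheta
  intro hu
  rw [toKummerData_kumY, CyclotomeCoefficients.kummerContMap_apply_eq _ _ _ u
    (RootSystem.ofRootableBy (u : (PadicAlgCl p)ˣ)), CyclotomeCoefficients.kummerContClass] at hu
  obtain ⟨a, ha⟩ := (ContH1.mk_eq_mk_iff _ _ _ _ _).mp hu
  have h1 := ha ⟨h, hh⟩
  have hcoe : ((⟨h, hh⟩ : ↥(D.GtpY.map D.toTheta)) : D.GtpTheta) = h := rfl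
  rw [MonoidHom.id_apply, hcoe, hcent a, mul_inv_cancel,
    C.kummerCocycle_eq_one_of_augTheta_eq_one _ _ u.2 hh haug, map_one, inv_one, one_mul] at h1
  exact hfh h1

/-- The same on `(Π^tp_Ÿ)^Θ` for `kumYdd` and `u ∈ K̈^×`. [cite: MochizukiEtTh2009, Prop 1.5 p.23] -/
theorem toKummerData_kumYdd_ne_mk (f : ↥(D.GtpYdd.map D.toTheta) → D.DeltaTheta)
    (hf : f ∈ contCocycles (MonoidHom.id D.GtpTheta) D.DeltaTheta (D.GtpYdd.map D.toTheta))
    {h : D.GtpTheta} (hh : h ∈ D.GtpYdd.map D.toTheta) (haug : C.augTheta h = 1)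
    (hcent : ∀ a : D.DeltaTheta, MulAut.conjNormal h a = a) (hfh : f ⟨h, hh⟩ ≠ 1) (u : C.invYdd) :
    C.toKummerData.kumYdd u ≠ ContH1.mk f hf := by
  letI := D.unitsAction C.augTheta
  intro hu
  rw [toKummerData_kumYdd, CyclotomeCoefficients.kummerContMap_apply_eq _ _ _ u
    (RootSystem.ofRootableBy (u : (PadicAlgCl p)ˣ)), CyclotomeCoefficients.kummerContClass] at hu
  obtain ⟨a, ha⟩ := (ContH1.mk_eq_mk_iff _ _ _ _ _).mp hu
  have h1 := ha ⟨h, hh⟩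
  have hcoe : ((⟨h, hh⟩ : ↥(D.GtpYdd.map D.toTheta)) : D.GtpTheta) = h := rfl
  rw [MonoidHom.id_apply, hcoe, hcent a, mul_inv_cancel,
    C.kummerCocycle_eq_one_of_augTheta_eq_one _ _ u.2 hh haug, map_one, inv_one, one_mul] at h1
  exact hfh h1

end KummerCore

/-! ### The `y`-coordinate classes are not Kummer classes of constants -/

namespace YCoordKit

variable (K : D.YCoordKit) (C : D.KummerCore)

/-- **`kumY u ≠ log(U)`** for every constant `u ∈ K^×`, given an element `h ∈ (Π^tp_Y)^Θ` with trivial Galois part,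
centralising `Δ_Θ`, at which the `y`-coordinate is non-trivial (`ι` injective). [cite: MochizukiEtTh2009, Prop 1.5 p.23] -/
theorem kumY_ne_logU (hinj : Function.Injective K.iota) {h : D.GtpTheta} (hh : h ∈ D.GtpY.map D.toTheta)
    (haug : C.augTheta h = 1) (hcent : ∀ a : D.DeltaTheta, MulAut.conjNormal h a = a) (hy : K.y h ≠ 1)
    (u : C.invY) : C.toKummerData.kumY u ≠ K.logU :=
  C.toKummerData_kumY_ne_mk K.logUFun K.logUFun_mem hh haug hcent
    (fun h0 => hy (hinj (h0.trans (map_one K.iota).symm))) u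

/-- **`log(U) ∉ F² = Im(kumY)`**. [cite: MochizukiEtTh2009, Prop 1.5 p.23] -/
theorem logU_not_mem_range_kumY (hinj : Function.Injective K.iota) {h : D.GtpTheta}
    (hh : h ∈ D.GtpY.map D.toTheta) (haug : C.augTheta h = 1)
    (hcent : ∀ a : D.DeltaTheta, MulAut.conjNormal h a = a) (hy : K.y h ≠ 1) :
    K.logU ∉ Set.range C.toKummerData.kumY := by
  rintro ⟨u, hu⟩
  exact K.kumY_ne_logU C hinj hh haug hcent hy u hu

/-- Integer powers of `log(U)` are the classes of the powers of the `y`-coordinate cocycle.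
[cite: MochizukiEtTh2009, Prop 1.5 p.23] -/
theorem logU_zpow (n : ℤ) : K.logU ^ n = ContH1.mk (K.logUFun ^ n) (zpow_mem K.logUFun_mem n) := rfl

/-- **`kumY u ≠ log(U)^n` for `n ≠ 0`** (`log(U)^ℤ ∩ F² = 1`: `Ẑ` is torsion-free, so `ι(ŷ(h))^n ≠ 1`).
[cite: MochizukiEtTh2009, Prop 1.5 p.23] -/
theorem kumY_ne_logU_zpow (hinj : Function.Injective K.iota) {h : D.GtpTheta} (hh : h ∈ D.GtpY.map D.toTheta)
    (haug : C.augTheta h = 1) (hcent : ∀ a : D.DeltaTheta, MulAut.conjNormal h a = a) (hy : K.y h ≠ 1)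
    {n : ℤ} (hn : n ≠ 0) (u : C.invY) : C.toKummerData.kumY u ≠ K.logU ^ n := by
  rw [logU_zpow]
  refine C.toKummerData_kumY_ne_mk _ _ hh haug hcent (fun h0 => ?_) u
  rw [Pi.pow_apply] at h0
  change K.iota (K.y h) ^ n = 1 at h0
  -- h0 : (ι (ŷ h)) ^ n = 1 ⇒ ŷ(h) ^ |n| = 1 in the torsion-free Ẑ
  have h1 : K.y h ^ n = 1 := hinj (by rw [map_zpow, h0, map_one])
  have h2 : K.y h ^ n.natAbs = 1 := by
    rcases Int.natAbs_eq n with hcase | hcase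
    · have : K.y h ^ (n.natAbs : ℤ) = 1 := by rw [← hcase]; exact h1
      exact_mod_cast this
    · have : K.y h ^ (-(n.natAbs : ℤ)) = 1 := by rw [← hcase]; exact h1
      rw [zpow_neg, inv_eq_one] at this
      exact_mod_cast this
  exact hy (Literature.AnabelianGeometry.AbsoluteAnabelian.ZHatCompletion.eq_one_of_pow_eq_one
    (Int.natAbs_ne_zero.mpr hn) h2)

/-- Hence the cyclic subgroup generated by `log(U)` meets `F² = Im(kumY)` trivially. [cite: MochizukiEtTh2009, Prop 1.5 p.23] -/
theorem zpowers_logU_inf_range_kumY (hinj : Function.Injective K.iota) {h : D.GtpTheta}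
    (hh : h ∈ D.GtpY.map D.toTheta) (haug : C.augTheta h = 1)
    (hcent : ∀ a : D.DeltaTheta, MulAut.conjNormal h a = a) (hy : K.y h ≠ 1) :
    Subgroup.zpowers K.logU ⊓ C.toKummerData.kumY.range = ⊥ := by
  refine (Subgroup.eq_bot_iff_forall _).mpr fun z hz => ?_
  obtain ⟨hz1, hz2⟩ := Subgroup.mem_inf.mp hz
  obtain ⟨n, rfl⟩ := Subgroup.mem_zpowers_iff.mp hz1
  obtain ⟨u, hu⟩ := hz2
  by_cases hn : n = 0
  · rw [hn, zpow_zero]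
  · exact absurd hu (K.kumY_ne_logU_zpow C hinj hh haug hcent hy hn u)

/-- **`log(U) ∈ F¹`**, generically: if the `y`-coordinate vanishes on `Δ_Θ` (and `Δ_Θ ≤ (Π^tp_Y)^Θ`), then
`log(U)|_{Δ_Θ} = 1` — its image in `F⁰/F¹ = Hom(Δ_Θ, Δ_Θ)` is trivial (print: `log(U)` lives in `F¹/F²`).
[cite: MochizukiEtTh2009, Prop 1.5 p.23] -/
theorem res_deltaTheta_logU (hle : D.DeltaTheta ≤ D.GtpY.map D.toTheta)
    (hy0 : ∀ d : D.GtpTheta, d ∈ D.DeltaTheta → K.y d = 1) :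
    ContH1.res (MonoidHom.id D.GtpTheta) D.DeltaTheta hle K.logU = 1 := by
  rw [logU, ← ContH1.mk_one]
  refine ContH1.mk_congr _ (funext fun d => ?_) _ _
  show K.iota (K.y (d : D.GtpTheta)) = 1
  rw [hy0 d d.2, map_one]

/-- **`kumYdd u ≠ log(Ü)`** for every constant `u ∈ K̈^×`, given `h ∈ (Π^tp_Ÿ)^Θ` with trivial Galois part,
centralising `Δ_Θ`, with `ŷ(h) ≠ 1` (then `ŷ(h)/2 ≠ 1` too). [cite: MochizukiEtTh2009, Prop 1.5 p.23] -/
theorem kumYdd_ne_logUdd (hinj : Function.Injective K.iota) {h : D.GtpTheta} (hh : h ∈ D.GtpYdd.map D.toTheta)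
    (haug : C.augTheta h = 1) (hcent : ∀ a : D.DeltaTheta, MulAut.conjNormal h a = a) (hy : K.y h ≠ 1)
    (u : C.invYdd) : C.toKummerData.kumYdd u ≠ K.logUdd := by
  refine C.toKummerData_kumYdd_ne_mk K.logUddFun K.logUddFun_mem hh haug hcent (fun h0 => ?_) u
  -- h0 : ι (half ⟨ŷ h, _⟩) = 1 ⇒ half = 1 ⇒ ŷ h = (half)² = 1
  have h1 : SettingModel.half ⟨K.y h, K.y_even h hh⟩ = 1 := hinj (h0.trans (map_one K.iota).symm)
  have h2 := SettingModel.half_sq ⟨K.y h, K.y_even h hh⟩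
  rw [h1, one_pow] at h2
  exact hy h2.symm

/-- **`log(Ü) ∉ F̈² = Im(kumYdd)`**. [cite: MochizukiEtTh2009, Prop 1.5 p.23] -/
theorem logUdd_not_mem_range_kumYdd (hinj : Function.Injective K.iota) {h : D.GtpTheta}
    (hh : h ∈ D.GtpYdd.map D.toTheta) (haug : C.augTheta h = 1)
    (hcent : ∀ a : D.DeltaTheta, MulAut.conjNormal h a = a) (hy : K.y h ≠ 1) :
    K.logUdd ∉ Set.range C.toKummerData.kumYdd := by
  rintro ⟨u, hu⟩
  exact K.kumYdd_ne_logUdd C hinj hh haug hcent hy u hu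

end YCoordKit

end ThetaSetting

end Literature.AnabelianGeometry.EtaleTheta

end
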